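import Summits.QuantumFields.BalabanUV.T4Continuum.Support.DirichletStarRenormReduction
import Summits.QuantumFields.BalabanUV.T4Continuum.Support.RegionSliceCoerciveBox

/-!
# T⁴ programme, spine node NE2 (U1a), sub-row Δ1 «NE2⁰-Dirichlet» — W3̃ ⟺ W3 ALONG THE STAR TOWER AT EVERY RATE `θ ≥ (√L)⁻¹`, and
# THE RENORMALISED STAR TOWER OF THE FAITHFUL `Δ_a(Ω₀)` ON A PRODUCT REGION MODULO W1 (ONE SLICE CONSTANT) AND KING's COMPRESSED
# INJECTED LAW W3 AT RATE `θ` — the renormalised law W3̃ no longer displayed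

NE2 formalisation swarm `b2b-balaban-t4-ne2-formalise-*`, LEAF PROVER 06 (gen 6), supplier item «Δ1-VEC-W3̃-TRACE» (journal
2026-08-20 l.20563), file 3 of 3, on file 2 `Support/DirichletStarRenormReduction` (per level: `J̃ = J·N`, the decomposition
`G′J̃ − J̃G = (G′J − JG)·N + J·[G, N]`, `‖[G_k, N_k]‖ ≤ 2(√L − 1)·√((2γ⁻¹ + CgI)·γ⁻¹/n_k)` from the trace inequality of file 1) and
leaf-07-g7's `Support/RegionInteriorW2` («Δ1-VEC-INTERIOR-W2-BOX»: `interiorW2_of_slice`, interior W2 ⟸ W1 on product regions with the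
level-free `CgIbox d a′ c`) / `Support/DirichletStarClassPoincare` (`towerLimitRate_star_renorm_of_interior_class`).

 * §5 ALONG THE TOWER (`2 ≤ L`, one coercivity constant `γ` (W1), interior W2 at the levels `k + 1` with one `CgI`, any
   `θ ∈ [(√L)⁻¹, 1)`; level `0` by the crude W1 bound): **`opNorm_comm_le_rate`** `‖G_k·N_k − N_k·G_k‖ ≤ Ctr·θ^k`,
   **`hinj_renorm_of_compressed`** (W3 at rate `θ` with constant `C₁` ⟹ W3̃ at rate `θ` with constant `√L·C₁ + Ctr`) and
   **`hinj_compressed_of_renorm`** (constant `C₁ + Ctr`), `Ctr = 2(√L − 1)·√((2γ⁻¹ + CgI)·γ⁻¹)` (written out): the renormalised star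
   towers' W3̃ (`DirichletStarRenormTower.towerLimitRate_star_renorm_of(_sq)`, `DirichletStarClassPoincare…_of_interior(_class)`,
   `RegionInteriorW2.towerLimitRate_star_renorm_box_of_slice(_rate)`) and the compressed star tower's W3
   (`DirichletStarVectorTower.towerLimitRate_star_of(_linear)`) are ONE binder at every rate `θ ≥ (√L)⁻¹`; by leaf-02-g7's
   `DirichletStarRenormSlabNoGo.not_renorm_injected_torus_rate` no better rate is available to W3̃ off `⊤`.
 * §6 the two ENDs **`towerLimitRate_star_renorm_box_of_slice_compressed (hL : 2 ≤ L) (hbox : IsCoordBox M S) (ha : 0 ≤ a) (ha′ : 0 < a′)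
   (hc : 0 < c) (hS : ∀ k, SliceCoercive_k … c) (hθ : (√L)⁻¹ ≤ θ) (hθ1 : θ < 1) (hinjK : ∀ k, ‖G_{k+1}·J_k − J_k·G_k‖ ≤ C₁·θ^k)`**:
   `TowerLimitRate (AnR …) (L^d) (k ↦ G_k) (Cpert 0 √(CgIbox/2·γ⋆⁻¹) (√L·C₁ + Ctr L γ⋆ CgIbox) 0 0 0) θ`, `G_k = (regionDeltaA (lev L k)
   M a a′ S)⁻¹`, `J_k = JpR L M (starP L M S) k` (King's COMPRESSED planting), `γ⋆ = gamStar d a′ c` — leaf-07-g7's product-region END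
   with the displayed injected law now the COMPRESSED tower's binder: ONE injected law for BOTH star towers; W1 displayed as ONE slice
   constant for all levels (`hS`), and on coordinate boxes `hS` = the owner's `RegionSliceCoerciveBox.sliceCoercive_lev_box` (O14-a file 5:
   W1 on boxes at every level from gen 5's `tent_face_comparison`), giving **`towerLimitRate_star_renorm_box_of_compressed (hL) (hbox) (ha : 0 < a) (ha′) (hθ) (hθ1) (hinjK)`**:
   the renormalised star tower of the faithful `Δ_a(Ω₀)` on EVERY COORDINATE BOX converges at every rate `θ ∈ [(√L)⁻¹, 1)` MODULO KING's
   COMPRESSED INJECTED LAW AT RATE `θ` ONLY — W1, the tent comparison, interior W2, the class-Poincaré socket and W3̃ all discharged by name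
   (the owner's operative END `RegionSliceCoerciveBox.towerLimitRate_star_renorm_box_sqrt` displays the renormalised `hinj` at `(√L)⁻¹` — by §5 the
   SAME binder as the compressed one up to constants; this END displays the compressed form, the one O14-b′ has to prove).

HONEST FRAMING (T4-DAG p. 1).  Bookkeeping over landed modules ([folklore]); model level (`U = 1`, ONE product region, ONE averaging
scale, finite torus, linear layer, operator norm); W1 (`hS`) and W3 for King's compressed planting (`hinjK`) DISPLAYED — W3 is NOT
proved anywhere in the tree (numerically at the torus rate on King's scalar model, `t4/T4-EST-NE2-D1-INJ.md`); Δ1 NOT closed; NE2 (U1a)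
NOT proved; spine PROVED 0/9 unchanged; NOT [B9] (3.16)/(3.23)–(3.27) as printed; NOT infinite volume, NOT a mass gap, NOT the Clay
problem, NOT summit progress.  HONEST DEPENDENCY: continuum YM on T⁴ ⇐ BetaPertH ∧ nine spine estimates (0/9 proved); BetaPertH ⇐
(D1) ∧ (D4) ∧ CAP+tail; G-an2-4 gates asym, D1 and NE2/3/4.  No `sorry`.
-/

noncomputable section

open scoped BigOperators ComplexConjugate Matrix Matrix.Norms.L2Operator

namespace Summit.QuantumFields.BalabanUV.T4Continuum.DirichletStarRenormBoxTower

open Literature.MathematicalPhysics.QuantumFieldTheory.Balaban1983to89.B5Prop11Plancherel (Tor fine)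
open Literature.MathematicalPhysics.QuantumFieldTheory.Balaban1983to89.B5Prop11Lower (nsq)
open Literature.MathematicalPhysics.QuantumFieldTheory.Balaban1983to89.B5G183RateUnitTower (lev)
open Summit.QuantumFields.BalabanUV.T4Continuum
open Summit.QuantumFields.BalabanUV.T4Continuum.CovariantAveragingTower (TowerLimitRate)
open Summit.QuantumFields.BalabanUV.T4Continuum.BackgroundResolventTower (Cpert)
open Summit.QuantumFields.BalabanUV.T4Continuum.BalabanAveragedTowerUnit (cast_lev')
open Summit.QuantumFields.BalabanUV.T4Continuum.SubtypeCompression (Coercive)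
open Summit.QuantumFields.BalabanUV.T4Continuum.DirichletSubregionTowerOf (pidx JpR)
open Summit.QuantumFields.BalabanUV.T4Continuum.DirichletSubregionRenormTower (JnR AnR)
open Summit.QuantumFields.BalabanUV.T4Continuum.RegionGaugeSlice (SliceCoercive)
open Summit.QuantumFields.BalabanUV.T4Continuum.RegionScalarCompression (QOm GOm)
open Summit.QuantumFields.BalabanUV.T4Continuum.RegionGaugeFixedVector (starReg curlR gradR avgR regionDeltaA)
open Summit.QuantumFields.BalabanUV.T4Continuum.DirichletStarVectorTower (starP gamStar gamStar_pos coercive_regionDeltaA_of_slice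
  two_le_lev_succ)
open Summit.QuantumFields.BalabanUV.T4Continuum.DirichletStarRenormTower (igrad)
open Summit.QuantumFields.BalabanUV.T4Continuum.DirichletStarClassPoincare (towerLimitRate_star_renorm_of_interior_class)
open Summit.QuantumFields.BalabanUV.T4Continuum.RegionInteriorW2 (CgIbox one_le_CgIbox interiorW2_of_slice)
open Summit.QuantumFields.BalabanUV.T4Continuum.RegionSliceCoerciveBoxTower (cW1box cW1box_pos)
open Summit.QuantumFields.BalabanUV.T4Continuum.RegionSliceCoerciveBox (sliceCoercive_lev_box)
open Summit.QuantumFields.BalabanUV.T4Continuum.DirichletStarRenormReduction (Nmat sqrt_sub_one_nonneg opNorm_comm_le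
  opNorm_comm_le_crude renorm_le_of_compressed compressed_le_of_renorm)
open Summit.QuantumFields.BalabanUV.Beta.GAN24.DirichletBoxTwoLevel (IsCoordBox)

variable {d : ℕ} (L : ℕ) [NeZero L] (M : Fin d → ℕ) [hM : ∀ μ, NeZero (M μ)] (S : Tor M → Prop) [DecidablePred S] (a a' : ℝ)

/-! ## §5 Along the tower: one binder at every rate `θ ≥ (√L)⁻¹` -/

section Tower

omit [NeZero L] in
/-- `√(1/n_k) = ((√L)⁻¹)^k`. [folklore] -/
theorem sqrt_inv_lev (k : ℕ) : Real.sqrt (((lev L k : ℕ) : ℝ)⁻¹) = ((Real.sqrt L)⁻¹) ^ k := by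
  have hL0 : (0 : ℝ) ≤ L := Nat.cast_nonneg L
  have e : ((L : ℝ)) ^ k = ((Real.sqrt L) ^ k) ^ 2 := by
    rw [← pow_mul, mul_comm k 2, pow_mul, Real.sq_sqrt hL0]
  rw [cast_lev' L k, Real.sqrt_inv, e, Real.sqrt_sq (pow_nonneg (Real.sqrt_nonneg _) k), inv_pow]

/-- **THE COMMUTATOR ALONG THE TOWER**: W1 at every level (one `γ`) + interior W2 at the levels `k + 1` (one `CgI`) ⟹ for every
`θ ≥ (√L)⁻¹`, `‖G_k·N_k − N_k·G_k‖ ≤ Ctr·θ^k` at EVERY level `k` (level `0` by the crude bound). [folklore] -/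
theorem opNorm_comm_le_rate (hL : 2 ≤ L) {γ CgI : ℝ} (hγ : 0 < γ) (hCgI : 0 ≤ CgI)
    (hcoer : ∀ k, Coercive (regionDeltaA (lev L k) M a a' S) γ)
    (hI : ∀ (k : ℕ) (w : pidx L M (starP L M S) (k + 1) → ℂ),
      ∑ μ, nsq (igrad M S (lev L (k + 1)) μ w) ≤ CgI * (star w ⬝ᵥ (regionDeltaA (lev L (k + 1)) M a a' S *ᵥ w)).re)
    {θ : ℝ} (hθ : (Real.sqrt L)⁻¹ ≤ θ) (k : ℕ) :
    ‖(regionDeltaA (lev L k) M a a' S)⁻¹ * Nmat L M S k - Nmat L M S k * (regionDeltaA (lev L k) M a a' S)⁻¹‖ ≤ (2 * (Real.sqrt L - 1) * Real.sqrt ((2 * γ⁻¹ + CgI) * γ⁻¹)) * θ ^ k := by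
  have hL1 : 1 ≤ L := le_trans (by norm_num) hL
  have hs : 0 ≤ Real.sqrt L - 1 := sqrt_sub_one_nonneg L hL1
  have hθ0 : 0 ≤ θ := le_trans (inv_nonneg.mpr (Real.sqrt_nonneg _)) hθ
  have hK : 0 ≤ (2 * γ⁻¹ + CgI) * γ⁻¹ := by positivity
  rcases k with _ | k
  · -- level 0: crude bound, `γ⁻¹ ≤ √((2γ⁻¹ + CgI)γ⁻¹)`
    rw [pow_zero, mul_one]
    refine (opNorm_comm_le_crude L M S a a' hL1 0 hγ (hcoer 0)).trans ?_
    have h1 : γ⁻¹ ≤ Real.sqrt ((2 * γ⁻¹ + CgI) * γ⁻¹) := by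
      rw [Real.le_sqrt (inv_nonneg.mpr hγ.le) hK]
      nlinarith [inv_pos.mpr hγ, mul_nonneg hCgI (inv_nonneg.mpr hγ.le)]
    exact mul_le_mul_of_nonneg_left h1 (by positivity)
  · refine (opNorm_comm_le L M S a a' hL1 (k + 1) hγ hCgI (hcoer (k + 1)) (hI k)).trans ?_
    rw [div_eq_mul_inv, Real.sqrt_mul hK, sqrt_inv_lev L (k + 1), mul_assoc (2 * (Real.sqrt L - 1))]
    exact mul_le_mul_of_nonneg_left (mul_le_mul_of_nonneg_left
      (pow_le_pow_left₀ (inv_nonneg.mpr (Real.sqrt_nonneg _)) hθ (k + 1)) (Real.sqrt_nonneg _)) (by positivity)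

/-- **W3̃ AT RATE θ FROM W3 AT RATE θ** (`θ ≥ (√L)⁻¹`): the renormalised star tower's injected law from King's compressed one, constant
`√L·C₁ + Ctr`. [folklore] -/
theorem hinj_renorm_of_compressed (hL : 2 ≤ L) {γ CgI : ℝ} (hγ : 0 < γ) (hCgI : 0 ≤ CgI)
    (hcoer : ∀ k, Coercive (regionDeltaA (lev L k) M a a' S) γ)
    (hI : ∀ (k : ℕ) (w : pidx L M (starP L M S) (k + 1) → ℂ),
      ∑ μ, nsq (igrad M S (lev L (k + 1)) μ w) ≤ CgI * (star w ⬝ᵥ (regionDeltaA (lev L (k + 1)) M a a' S *ᵥ w)).re)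
    {θ C₁ : ℝ} (hθ : (Real.sqrt L)⁻¹ ≤ θ)
    (hinjK : ∀ k, ‖(regionDeltaA (lev L (k + 1)) M a a' S)⁻¹ * JpR L M (starP L M S) k
        - JpR L M (starP L M S) k * (regionDeltaA (lev L k) M a a' S)⁻¹‖ ≤ C₁ * θ ^ k) (k : ℕ) :
    ‖(regionDeltaA (lev L (k + 1)) M a a' S)⁻¹ * JnR L M (starP L M S) k
        - JnR L M (starP L M S) k * (regionDeltaA (lev L k) M a a' S)⁻¹‖ ≤ (Real.sqrt L * C₁ + (2 * (Real.sqrt L - 1) * Real.sqrt ((2 * γ⁻¹ + CgI) * γ⁻¹))) * θ ^ k := by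
  have hL1 : 1 ≤ L := le_trans (by norm_num) hL
  have h1 := renorm_le_of_compressed L M S hL1 k ((regionDeltaA (lev L (k + 1)) M a a' S)⁻¹) ((regionDeltaA (lev L k) M a a' S)⁻¹)
  have h2 := opNorm_comm_le_rate L M S a a' hL hγ hCgI hcoer hI hθ k
  have h3 := mul_le_mul_of_nonneg_left (hinjK k) (Real.sqrt_nonneg (L : ℝ))
  calc _ ≤ _ := h1
    _ ≤ Real.sqrt L * (C₁ * θ ^ k) + (2 * (Real.sqrt L - 1) * Real.sqrt ((2 * γ⁻¹ + CgI) * γ⁻¹)) * θ ^ k := add_le_add h3 h2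
    _ = (Real.sqrt L * C₁ + (2 * (Real.sqrt L - 1) * Real.sqrt ((2 * γ⁻¹ + CgI) * γ⁻¹))) * θ ^ k := by ring

/-- **W3 AT RATE θ FROM W3̃ AT RATE θ** (`θ ≥ (√L)⁻¹`): the converse, constant `C₁ + Ctr`. [folklore] -/
theorem hinj_compressed_of_renorm (hL : 2 ≤ L) {γ CgI : ℝ} (hγ : 0 < γ) (hCgI : 0 ≤ CgI)
    (hcoer : ∀ k, Coercive (regionDeltaA (lev L k) M a a' S) γ)
    (hI : ∀ (k : ℕ) (w : pidx L M (starP L M S) (k + 1) → ℂ),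
      ∑ μ, nsq (igrad M S (lev L (k + 1)) μ w) ≤ CgI * (star w ⬝ᵥ (regionDeltaA (lev L (k + 1)) M a a' S *ᵥ w)).re)
    {θ C₁ : ℝ} (hθ : (Real.sqrt L)⁻¹ ≤ θ)
    (hinjR : ∀ k, ‖(regionDeltaA (lev L (k + 1)) M a a' S)⁻¹ * JnR L M (starP L M S) k
        - JnR L M (starP L M S) k * (regionDeltaA (lev L k) M a a' S)⁻¹‖ ≤ C₁ * θ ^ k) (k : ℕ) :
    ‖(regionDeltaA (lev L (k + 1)) M a a' S)⁻¹ * JpR L M (starP L M S) k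
        - JpR L M (starP L M S) k * (regionDeltaA (lev L k) M a a' S)⁻¹‖ ≤ (C₁ + (2 * (Real.sqrt L - 1) * Real.sqrt ((2 * γ⁻¹ + CgI) * γ⁻¹))) * θ ^ k := by
  have hL1 : 1 ≤ L := le_trans (by norm_num) hL
  have h1 := compressed_le_of_renorm L M S hL1 k ((regionDeltaA (lev L (k + 1)) M a a' S)⁻¹) ((regionDeltaA (lev L k) M a a' S)⁻¹)
  have h2 := opNorm_comm_le_rate L M S a a' hL hγ hCgI hcoer hI hθ k
  calc _ ≤ _ := h1
    _ ≤ C₁ * θ ^ k + (2 * (Real.sqrt L - 1) * Real.sqrt ((2 * γ⁻¹ + CgI) * γ⁻¹)) * θ ^ k := add_le_add (hinjR k) h2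
    _ = (C₁ + (2 * (Real.sqrt L - 1) * Real.sqrt ((2 * γ⁻¹ + CgI) * γ⁻¹))) * θ ^ k := by ring

end Tower


/-! ## §6 The product-region END -/

omit [NeZero L] in
/-- `(√L)⁻¹ ≤ θ` gives `1 ≤ L·θ` (`1 ≤ L`), hence the constant class `CgI ≤ CgI·((L·θ)^k)²`. [folklore] -/
theorem one_le_mul_of_sqrt_inv_le (hL : 1 ≤ L) {θ : ℝ} (hθ : (Real.sqrt L)⁻¹ ≤ θ) : 1 ≤ (L : ℝ) * θ := by
  have hL1 : (1 : ℝ) ≤ L := by exact_mod_cast hL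
  have hs1 : 1 ≤ Real.sqrt L := by rw [← Real.sqrt_one]; exact Real.sqrt_le_sqrt hL1
  have hs0 : 0 < Real.sqrt L := lt_of_lt_of_le one_pos hs1
  have hsL : Real.sqrt L ≤ L := by nlinarith [Real.mul_self_sqrt (le_trans zero_le_one hL1)]
  have h1 : 1 ≤ Real.sqrt L * θ := by
    have := mul_le_mul_of_nonneg_left hθ hs0.le
    rwa [mul_inv_cancel₀ hs0.ne'] at this
  have hθ0 : 0 ≤ θ := le_trans (inv_nonneg.mpr hs0.le) hθ
  nlinarith [mul_le_mul_of_nonneg_right hsL hθ0]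

/-- **THE RENORMALISED STAR TOWER ON A PRODUCT REGION AT RATE `θ ∈ [(√L)⁻¹, 1)` MODULO W1 + KING's COMPRESSED INJECTED LAW AT RATE `θ`.**
DISPLAYED: `hS` (ONE slice constant for all levels), `hinjK` (the compressed tower's injected law).  Interior W2, the class-Poincaré
socket and the renormalised injected law are discharged BY NAME (leaf-07-g7, file 2). [folklore] -/
theorem towerLimitRate_star_renorm_box_of_slice_compressed (hL : 2 ≤ L) (hbox : IsCoordBox M S) (ha : 0 ≤ a) (ha' : 0 < a')
    {c : ℝ} (hc : 0 < c)
    (hS : ∀ k, SliceCoercive (curlR (lev L k) M S) (gradR (lev L k) M S) (GOm (lev L k) M a' S) (QOm (lev L k) M S)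
      (avgR (lev L k) M S) (a * ((lev L k : ℕ) : ℝ) ^ d) c)
    {θ C₁ : ℝ} (hθ : (Real.sqrt L)⁻¹ ≤ θ) (hθ1 : θ < 1)
    (hinjK : ∀ k, ‖(regionDeltaA (lev L (k + 1)) M a a' S)⁻¹ * JpR L M (starP L M S) k
        - JpR L M (starP L M S) k * (regionDeltaA (lev L k) M a a' S)⁻¹‖ ≤ C₁ * θ ^ k) :
    TowerLimitRate (AnR L M (starP L M S)) ((L : ℝ) ^ d) (fun k => (regionDeltaA (lev L k) M a a' S)⁻¹)
      (Cpert 0 (Real.sqrt (CgIbox d a' c / 2 * (gamStar d a' c)⁻¹))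
        (Real.sqrt L * C₁ + (2 * (Real.sqrt L - 1) * Real.sqrt ((2 * (gamStar d a' c)⁻¹ + CgIbox d a' c) * (gamStar d a' c)⁻¹))) 0 0 0) θ := by
  have hL1 : 1 ≤ L := le_trans (by norm_num) hL
  have hγ : 0 < gamStar d a' c := gamStar_pos (d := d) a' hc
  have hCg1 : 1 ≤ CgIbox d a' c := one_le_CgIbox (d := d) a' ha' hc
  have hCg0 : 0 ≤ CgIbox d a' c := zero_le_one.trans hCg1
  have hθ0 : 0 ≤ θ := le_trans (inv_nonneg.mpr (Real.sqrt_nonneg _)) hθ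
  have hcoer : ∀ k, Coercive (regionDeltaA (lev L k) M a a' S) (gamStar d a' c) :=
    fun k => coercive_regionDeltaA_of_slice (lev L k) M a a' S ha' hc (hS k)
  have hI : ∀ (k : ℕ) (w : pidx L M (starP L M S) (k + 1) → ℂ),
      ∑ μ, nsq (igrad M S (lev L (k + 1)) μ w) ≤ CgIbox d a' c * (star w ⬝ᵥ (regionDeltaA (lev L (k + 1)) M a a' S *ᵥ w)).re :=
    fun k w => interiorW2_of_slice (lev L (k + 1)) M a a' S (two_le_lev_succ L hL k) hbox ha ha' hc (hS (k + 1)) w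
  have hinjR := hinj_renorm_of_compressed L M S a a' hL hγ hCg0 hcoer hI hθ hinjK
  have hLθ : 1 ≤ (L : ℝ) * θ := one_le_mul_of_sqrt_inv_le L hL1 hθ
  have hCg : ∀ k : ℕ, CgIbox d a' c ≤ CgIbox d a' c * ((((L : ℝ) * θ) ^ k)) ^ 2 := fun k => by
    have h1 : (1 : ℝ) ≤ (((L : ℝ) * θ) ^ k) ^ 2 := one_le_pow₀ (one_le_pow₀ hLθ)
    nlinarith
  exact towerLimitRate_star_renorm_of_interior_class L M S a a' ha' hc hS hθ0 hθ1 (fun _ => hCg0) hCg hI hinjR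

/-- **THE RENORMALISED STAR TOWER OF THE FAITHFUL `Δ_a(Ω₀)` ON A COORDINATE BOX AT RATE `θ ∈ [(√L)⁻¹, 1)` MODULO KING's COMPRESSED
INJECTED LAW AT RATE `θ` ONLY** (`hinjK` — the binder of `DirichletStarVectorTower.towerLimitRate_star_of(_linear)`).  W1 (the owner's `sliceCoercive_lev_box`),
interior W2 (leaf-07-g7), the class-Poincaré socket (leaf-07-g7 / owner) and the renormalised injected law (§5) are discharged BY NAME. [folklore] -/
theorem towerLimitRate_star_renorm_box_of_compressed (hL : 2 ≤ L) (hbox : IsCoordBox M S) (ha : 0 < a) (ha' : 0 < a')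
    {θ C₁ : ℝ} (hθ : (Real.sqrt L)⁻¹ ≤ θ) (hθ1 : θ < 1)
    (hinjK : ∀ k, ‖(regionDeltaA (lev L (k + 1)) M a a' S)⁻¹ * JpR L M (starP L M S) k
        - JpR L M (starP L M S) k * (regionDeltaA (lev L k) M a a' S)⁻¹‖ ≤ C₁ * θ ^ k) :
    TowerLimitRate (AnR L M (starP L M S)) ((L : ℝ) ^ d) (fun k => (regionDeltaA (lev L k) M a a' S)⁻¹)
      (Cpert 0 (Real.sqrt (CgIbox d a' (cW1box d a a' 4) / 2 * (gamStar d a' (cW1box d a a' 4))⁻¹))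
        (Real.sqrt L * C₁ + (2 * (Real.sqrt L - 1) * Real.sqrt ((2 * (gamStar d a' (cW1box d a a' 4))⁻¹ + CgIbox d a' (cW1box d a a' 4))
          * (gamStar d a' (cW1box d a a' 4))⁻¹))) 0 0 0) θ :=
  towerLimitRate_star_renorm_box_of_slice_compressed L M S a a' hL hbox ha.le ha' (cW1box_pos a a' ha ha')
    (sliceCoercive_lev_box M a a' S L hL hbox ha ha') hθ hθ1 hinjK

end Summit.QuantumFields.BalabanUV.T4Continuum.DirichletStarRenormBoxTower

end
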